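import Summits.QuantumFields.YangMills.Theorems.BalabanUVNodesN15SiteCurvedOperatorEntries
import HarnessLib

/-!
# Route «BalabanUVNodes», cluster K4 «SpineRates» — node N15 = NE2: THE SITE LAYER WITH THE BACKGROUND LIVE IN THE TwoGrid ENTRY CURRENCY, XLIII — THE LEFT-PIECE LETTERS OF
# THE CURVED KING FAMILY AT THE FLAT BASE POINT: `G ⊗ 1`, `D⁺_μG = (N∇_μA₀⁻¹) ⊗ 1`, `D⁻_μG = (S_{−μ}N∇_μA₀⁻¹) ⊗ 1` on both grids with their two-grid η-defects, on the CLOSED mass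
# range, in the shapes of dag-n15-c's FILE 23 hypotheses `hG`, `hD`, `hG'`, `hD'`, `hDG`, `hDD` AT THE CURVED KING FAMILY (part XXX's `kingFullProp_layer_backward_massRange` through
# dag-n15-e Ω-b's four piece dictionaries and casts)

Cell `pub-ymgap`, WIDTH SEAT `pub-ymgap-dag-n15-w1` (generation 5; director-ym №197 ∕ HUMAN RULING D-0149, №219 (1); chair R455 (A) ∕ R461; dag-lead KEY MAP v2 INBOX l.35754;
the located sequel (o1) of dag-n15-e g15 INBOX l.39322 ∕ l.39620; dag-n15-d g18 l.40235 (door (2)); CLAIM-8).  `bears_on: R4∕N15 · K3⁸ SpineGivenEndpointR13SepCoPHV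
(stmt-QuantumFields-27366; K3⁷ 20544 aside = lineage)`.  Filed `--kind proof --supports stmt-QuantumFields-27366 --as helper` — COUNT-NEUTRAL.  THEOREMS ONLY (0 `def`,
0 `sorry`).  Imports BY NAME part XXXVI `…N15SiteCurvedOperatorEntries` (p642830; through it part XXX `…N15SiteCurvedKnitMassless` ★ `kingFullProp_layer_backward_massRange`
(dag-n15-e Ω-c `kingFullProp_uniform_layer_backward` on the closed mass range by part VII), dag-n15-e Ω-b `covPieces_flat_coarse_inl`∕`_inr`∕`covPieces_flat_fine_inl`∕`_inr`,
`kingGT`∕`kingGT₁`∕`kingGOp₁`, Ω-a `castT`∕`hasMaj_conjEquiv`∕`hasMaj_pullEquiv_comp`∕`idef_conj_eq`∕`blockOf_comp_blockOf_eq`, dag-n15-c `hasMaj_tensorId`∕`idef_tensorId`,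
n15-w3 `covPieces`); nothing in the tree is modified.

WHY.  Part XLII identified the curved King family's entry 2 (`X∇*`, displayed in part XL) with dag-n15-c's by-parts object, so part XL's row `h2` IS FILE 23 ★★
`hasMaj_entry2_byParts_matrix₂_of_letters` at this family.  FILE 23 reads the `U ≡ 1` letters of the undressed propagator `G` and of its LEFT pieces `D_s`, `s ∈ J ⊕ J` — at the
flat base point `D = covPieces η τ 1 G = (∇_μG, ∇⁻_μG)` (n15-w3 `covPieces_one`) — on both grids with their two-grid defects (`hG`, `hD`, `hG'`, `hD'`, `hDG`, `hDD`).  For the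
curved King family these are part XXX's nine scalar letters (`kingFullProp_layer_backward_massRange`: `A₀⁻¹`, `N∇_μA₀⁻¹`, `S_{−μ}N∇_μA₀⁻¹`, coarse and fine, and the three
defects, on `0 ≤ m² ≤ m₀²`) read `⊗ 1` through Ω-b's dictionaries and Ω-a's cast — typed here BY NAME in FILE 23's shapes (part XLI did the right entry and the shifts).

CONTENTS.  ★★ `curvG_letters_massRange` (`hG`, `hG'`, `hDG`), ★★ `curvPieces_letters_massRange` (`hD`, `hD'`, `hDD` for every `s ∈ J ⊕ J`), one `(β, δ, m₀)` each, rate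
`(L^K)^{−γ∕2}` (`0 < γ < 1`; Ω-c's backward Hölder exponent taken `= γ∕2`).

HONEST FRAMING ∕ LIMITS.  Count-neutral KNIT plumbing over landed theorems; no new estimate (inputs: Ψ-e ∕ P″ ∕ Q4a ∕ W-b via Ω-c ∕ part XXX, VII).  King's `A = 0` MODEL ([King1986]
(2.13) p. 653), `U ≡ 1` letters only; nothing of [B5]∕[B6]∕[B9] asserted ((3.42) p. 397, (3.64) p. 403 = SHAPES).  It does NOT discharge entry 2 of part XXXVI; NE2⁺ NOT PRINTED ∕
NOT proved for d = 4; **N15 is NOT discharged**; K3⁸ OPEN, not claimed, skeleton v6 untouched; counts of record UNMOVED (typed 28∕28 · discharged 5∕27, A 5∕28); one finite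
four-torus programme at fixed `ε` — NOT ℝ⁴, NOT infinite volume, NOT OS, NOT a mass gap, NOT Clay; R4 closes the conditional finite-𝕋⁴ rung `BalabanLadder.UV` only.  HONEST SCOPE:
odd `L ≥ 3`, `a > 0`, cubes `2L^e`, `K ≥ 1`, one blocking step, `0 ≤ m² ≤ m₀²`, `0 < γ < 1`, sharp block sup sizes.  Restate-immune (no Theses import).
-/

set_option autoImplicit false

noncomputable section
open scoped BigOperators Matrix

namespace Summit.QuantumFields.YangMills.BalabanUVNodes.N15.SiteLayerBg

open Real Finset
open Literature.MathematicalPhysics.QuantumFieldTheory.Balaban1983to89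
open Literature.MathematicalPhysics.QuantumFieldTheory.Balaban1983to89.B11SectG (BlockNorm HasMaj)
open Literature.MathematicalPhysics.QuantumFieldTheory.Balaban1983to89.T4EtaRateDefect (idef)
open Literature.MathematicalPhysics.QuantumFieldTheory.Balaban1983to89.T4EtaRateCoeffDefect (pull)
open Literature.MathematicalPhysics.QuantumFieldTheory.Balaban1983to89.B5Prop11Plancherel (Tor fine unitVec)
open Literature.MathematicalPhysics.QuantumFieldTheory.King1986.Torus (blockOf tdistT tdistT_nonneg)
open Summit.QuantumFields.YangMills.BalabanUVNodes.N15.VectorPiece (unitTorusGeoS tensorId hasMaj_tensorId idef_tensorId)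
open Summit.QuantumFields.YangMills.BalabanUVNodes.N15.MatrixSpecies (liftMap liftBlk)
open Summit.QuantumFields.YangMills.BalabanUVNodes.N15.CurvedSpecies (torStep covPieces)
open Summit.QuantumFields.YangMills.BalabanUVNodes.N15KingModelRung (KingVolIndex)
open Summit.QuantumFields.YangMills.BalabanUVNodes.N15KingModelRung.Curved

variable {d : ℕ} (L : ℕ) [NeZero L]
variable (κ : Type) [Fintype κ] [DecidableEq κ] (a : ℝ)

omit [DecidableEq κ] in
/-- ★★ **THE PROPAGATOR LETTERS OF THE CURVED KING FAMILY ON THE CLOSED MASS RANGE** (FILE 23's `hG`, `hG'`, `hDG`): for odd `L ≥ 3`, `a > 0`, `m₀² ≥ 0`, `0 < γ < 1` there are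
`β, δ, m₀ > 0` with, for every index `i` and mass `0 ≤ m² ≤ m₀²`: `G ⊗ 1 ≤ βe^{−δ|y−y′|_T}` (coarse coloured cubes), `G′₁ ⊗ 1 ≤ βe^{−δ|y−y′|_T}` (nested fine coloured cubes),
`𝔇(G′₁ ⊗ 1, G ⊗ 1) ≤ m₀(L^K)^{−γ∕2}e^{−δ|y−y′|_T}` through the colour-lifted one-step block map. [cite: King1986, (2.17) p.653, (2.20) p.654, Prop. 3.8 (3.71) p.664, p.664 (pairing), (4.1)–(4.5) p.670; Balaban1985BackgroundPropagators, Thm 3.1 (3.42) p.397 (first entry, shape)] -/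
theorem curvG_letters_massRange (hLodd : Odd L) (hL : 2 ≤ L) (ha : 0 < a) {m0sq : ℝ} (hm0 : 0 ≤ m0sq) {γ : ℝ} (hγ0 : 0 < γ) (hγ1 : γ < 1) :
    ∃ β δ m₀ : ℝ, 0 < β ∧ 0 < δ ∧ 0 < m₀ ∧ ∀ (i : KingVolIndex d) (msq : ℝ), 0 ≤ msq → msq ≤ m0sq →
      HasMaj (BlockNorm.ofBlocks (unitTorusGeoS L i.K (curvCube L i) i.Msz) (liftBlk (blockOf (L ^ i.K) (curvCube L i)) κ))
          (BlockNorm.ofBlocks (unitTorusGeoS L i.K (curvCube L i) i.Msz) (liftBlk (blockOf (L ^ i.K) (curvCube L i)) κ))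
          (kingGT L a msq i.K (curvCube L i) κ) (fun y y' => β * Real.exp (-(δ * tdistT (curvCube L i) y y')))
      ∧ HasMaj (BlockNorm.ofBlocks (unitTorusGeoS L i.K (curvCube L i) i.Msz) (liftBlk (blockOf (L ^ i.K) (curvCube L i) ∘ blockOf L (fine (L ^ i.K) (curvCube L i))) κ))
          (BlockNorm.ofBlocks (unitTorusGeoS L i.K (curvCube L i) i.Msz) (liftBlk (blockOf (L ^ i.K) (curvCube L i) ∘ blockOf L (fine (L ^ i.K) (curvCube L i))) κ))
          (kingGT₁ L a msq i.K (curvCube L i) κ) (fun y y' => β * Real.exp (-(δ * tdistT (curvCube L i) y y')))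
      ∧ HasMaj (BlockNorm.ofBlocks (unitTorusGeoS L i.K (curvCube L i) i.Msz) (liftBlk (blockOf (L ^ i.K) (curvCube L i)) κ))
          (BlockNorm.ofBlocks (unitTorusGeoS L i.K (curvCube L i) i.Msz) (liftBlk (blockOf (L ^ i.K) (curvCube L i) ∘ blockOf L (fine (L ^ i.K) (curvCube L i))) κ))
          (idef (pull (liftMap (blockOf L (fine (L ^ i.K) (curvCube L i))) κ)) (pull (liftMap (blockOf L (fine (L ^ i.K) (curvCube L i))) κ))
            (kingGT₁ L a msq i.K (curvCube L i) κ) (kingGT L a msq i.K (curvCube L i) κ))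
          (fun y y' => m₀ * ((L : ℝ) ^ i.K) ^ (-(γ / 2)) * Real.exp (-(δ * tdistT (curvCube L i) y y'))) := by
  obtain ⟨β, δ, m, hβ, hδ, hm, H⟩ := kingFullProp_layer_backward_massRange (d := d) L hLodd hL ha hm0 hγ0.le hγ1 (half_pos hγ0) (by linarith)
  refine ⟨β, δ, 2 * m, hβ, hδ, by positivity, fun i msq hmsq hcap => ?_⟩
  have hLr : (0 : ℝ) ≤ (L : ℝ) := Nat.cast_nonneg _
  obtain ⟨h1, -, -, h4, -, -, h7, -, -⟩ := H i.K i.one_le_K 1 le_rfl i.m (curvCube L i) (fun _ => rfl) msq hmsq hcap i.Msz 0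
  have maj0 : ∀ y y' : Tor (curvCube L i), 0 ≤ β * Real.exp (-(δ * tdistT (curvCube L i) y y')) := fun _ _ => by positivity
  have hθ : 0 ≤ ((L : ℝ) ^ i.K) ^ (-(γ / 2)) := Real.rpow_nonneg (pow_nonneg hLr _) _
  have majm : ∀ y y' : Tor (curvCube L i), 0 ≤ 2 * m * ((L : ℝ) ^ i.K) ^ (-(γ / 2)) * Real.exp (-(δ * tdistT (curvCube L i) y y')) := fun _ _ => by positivity
  have h7' : HasMaj (BlockNorm.ofBlocks (unitTorusGeoS L i.K (curvCube L i) i.Msz) (blockOf (L ^ i.K) (curvCube L i)))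
      (BlockNorm.ofBlocks (unitTorusGeoS L i.K (curvCube L i) i.Msz) (blockOf (L ^ i.K) (curvCube L i) ∘ underPtN L i.K 1 (curvCube L i)))
      (idef (pull (underPtN L i.K 1 (curvCube L i))) (pull (underPtN L i.K 1 (curvCube L i))) (kingGOp L a msq (i.K + 1) (L ^ 1 * L ^ i.K) (curvCube L i))
        (kingGOp L a msq i.K (L ^ i.K) (curvCube L i)))
      (fun y y' => 2 * m * ((L : ℝ) ^ i.K) ^ (-(γ / 2)) * Real.exp (-(δ * tdistT (curvCube L i) y y'))) :=
    h7.mono fun y y' => le_of_eq (by ring)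
  refine ⟨?_, ?_, ?_⟩
  · exact hasMaj_tensorId κ maj0 h1
  · rw [kingGT₁, kingGOp₁, blockOf_comp_blockOf_eq]
    exact hasMaj_tensorId κ maj0 (hasMaj_conjEquiv _ _ (castT L i.K (curvCube L i)) maj0 h4)
  · rw [kingGT₁, kingGT, kingGOp₁, idef_tensorId]
    refine hasMaj_tensorId κ majm ?_
    rw [idef_conj_eq, blockOf_comp_blockOf_eq]
    exact hasMaj_pullEquiv_comp _ (castT L i.K (curvCube L i)) majm h7'

/-- ★★ **THE LEFT-PIECE LETTERS OF THE CURVED KING FAMILY ON THE CLOSED MASS RANGE** (FILE 23's `hD`, `hD'`, `hDD` at the flat base point, BOTH orientations): for odd `L ≥ 3`,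
`a > 0`, `m₀² ≥ 0`, `0 < γ < 1` there are `β, δ, m₀ > 0` with, for every index `i`, mass `0 ≤ m² ≤ m₀²` and slot `s ∈ J ⊕ J` (`J = Fin (d+1)`): the coarse piece
`covPieces η 1 (G ⊗ 1) s` (`= N∇_μA₀⁻¹ ⊗ 1` ∕ `S_{−μ}N∇_μA₀⁻¹ ⊗ 1`, Ω-b) has rows `βe^{−δ|y−y′|_T}`, the fine piece `covPieces η′ 1 (G′₁ ⊗ 1) s` the same on the nested fine cubes, and
their two-grid defect through the colour-lifted one-step block map is `≤ m₀(L^K)^{−γ∕2}e^{−δ|y−y′|_T}` (`η = L(L^{K+1})⁻¹`, `η′ = (L^{K+1})⁻¹`).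
[cite: King1986, (2.17) p.653, (2.20) p.654, Prop. 3.9 (3.73) p.665, p.664 (pairing); Balaban1985BackgroundPropagators, Thm 3.1 (3.42)–(3.43) pp.397–398 (second entry, shape), (3.64) p.403 (the pieces: shape); Balaban1984PropagatorsI, Prop. 1.2 (1.110)–(1.111) p.35 (backward step: shape)] -/
theorem curvPieces_letters_massRange (hLodd : Odd L) (hL : 2 ≤ L) (ha : 0 < a) {m0sq : ℝ} (hm0 : 0 ≤ m0sq) {γ : ℝ} (hγ0 : 0 < γ) (hγ1 : γ < 1) :
    ∃ β δ m₀ : ℝ, 0 < β ∧ 0 < δ ∧ 0 < m₀ ∧ ∀ (i : KingVolIndex d) (msq : ℝ), 0 ≤ msq → msq ≤ m0sq → ∀ s : Fin (d + 1) ⊕ Fin (d + 1),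
      HasMaj (BlockNorm.ofBlocks (unitTorusGeoS L i.K (curvCube L i) i.Msz) (liftBlk (blockOf (L ^ i.K) (curvCube L i)) κ))
          (BlockNorm.ofBlocks (unitTorusGeoS L i.K (curvCube L i) i.Msz) (liftBlk (blockOf (L ^ i.K) (curvCube L i)) κ))
          (covPieces ((L : ℝ) * ((L : ℝ) ^ (i.K + 1))⁻¹) (torStep (fine (L ^ i.K) (curvCube L i))) (fun _ _ => (1 : Matrix κ κ ℝ)) (kingGT L a msq i.K (curvCube L i) κ) s)
          (fun y y' => β * Real.exp (-(δ * tdistT (curvCube L i) y y')))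
      ∧ HasMaj (BlockNorm.ofBlocks (unitTorusGeoS L i.K (curvCube L i) i.Msz) (liftBlk (blockOf (L ^ i.K) (curvCube L i) ∘ blockOf L (fine (L ^ i.K) (curvCube L i))) κ))
          (BlockNorm.ofBlocks (unitTorusGeoS L i.K (curvCube L i) i.Msz) (liftBlk (blockOf (L ^ i.K) (curvCube L i) ∘ blockOf L (fine (L ^ i.K) (curvCube L i))) κ))
          (covPieces (((L : ℝ) ^ (i.K + 1))⁻¹) (torStep (fine L (fine (L ^ i.K) (curvCube L i)))) (fun _ _ => (1 : Matrix κ κ ℝ)) (kingGT₁ L a msq i.K (curvCube L i) κ) s)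
          (fun y y' => β * Real.exp (-(δ * tdistT (curvCube L i) y y')))
      ∧ HasMaj (BlockNorm.ofBlocks (unitTorusGeoS L i.K (curvCube L i) i.Msz) (liftBlk (blockOf (L ^ i.K) (curvCube L i)) κ))
          (BlockNorm.ofBlocks (unitTorusGeoS L i.K (curvCube L i) i.Msz) (liftBlk (blockOf (L ^ i.K) (curvCube L i) ∘ blockOf L (fine (L ^ i.K) (curvCube L i))) κ))
          (idef (pull (liftMap (blockOf L (fine (L ^ i.K) (curvCube L i))) κ)) (pull (liftMap (blockOf L (fine (L ^ i.K) (curvCube L i))) κ))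
            (covPieces (((L : ℝ) ^ (i.K + 1))⁻¹) (torStep (fine L (fine (L ^ i.K) (curvCube L i)))) (fun _ _ => (1 : Matrix κ κ ℝ)) (kingGT₁ L a msq i.K (curvCube L i) κ) s)
            (covPieces ((L : ℝ) * ((L : ℝ) ^ (i.K + 1))⁻¹) (torStep (fine (L ^ i.K) (curvCube L i))) (fun _ _ => (1 : Matrix κ κ ℝ)) (kingGT L a msq i.K (curvCube L i) κ) s))
          (fun y y' => m₀ * ((L : ℝ) ^ i.K) ^ (-(γ / 2)) * Real.exp (-(δ * tdistT (curvCube L i) y y'))) := by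
  obtain ⟨β, δ, m, hβ, hδ, hm, H⟩ := kingFullProp_layer_backward_massRange (d := d) L hLodd hL ha hm0 hγ0.le hγ1 (half_pos hγ0) (by linarith)
  refine ⟨β, δ, 2 * m, hβ, hδ, by positivity, fun i msq hmsq hcap s => ?_⟩
  have hLr : (0 : ℝ) ≤ (L : ℝ) := Nat.cast_nonneg _
  have maj0 : ∀ y y' : Tor (curvCube L i), 0 ≤ β * Real.exp (-(δ * tdistT (curvCube L i) y y')) := fun _ _ => by positivity
  have hθ : 0 ≤ ((L : ℝ) ^ i.K) ^ (-(γ / 2)) := Real.rpow_nonneg (pow_nonneg hLr _) _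
  have majm : ∀ y y' : Tor (curvCube L i), 0 ≤ 2 * m * ((L : ℝ) ^ i.K) ^ (-(γ / 2)) * Real.exp (-(δ * tdistT (curvCube L i) y y')) := fun _ _ => by positivity
  have wk : ∀ y y' : Tor (curvCube L i), m * ((((L : ℝ) ^ i.K) ^ (-(γ / 2))) + (((L : ℝ) ^ i.K) ^ (-(γ / 2)))) * Real.exp (-(δ * tdistT (curvCube L i) y y')) ≤
      2 * m * ((L : ℝ) ^ i.K) ^ (-(γ / 2)) * Real.exp (-(δ * tdistT (curvCube L i) y y')) := fun y y' => le_of_eq (by ring)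
  cases s with
  | inl μ =>
    obtain ⟨-, h2, -, -, h5, -, -, h8, -⟩ := H i.K i.one_le_K 1 le_rfl i.m (curvCube L i) (fun _ => rfl) msq hmsq hcap i.Msz μ
    refine ⟨?_, ?_, ?_⟩
    · rw [covPieces_flat_coarse_inl]
      exact hasMaj_tensorId κ maj0 h2
    · rw [covPieces_flat_fine_inl, blockOf_comp_blockOf_eq]
      exact hasMaj_tensorId κ maj0 (hasMaj_conjEquiv _ _ (castT L i.K (curvCube L i)) maj0 h5)
    · rw [covPieces_flat_fine_inl, covPieces_flat_coarse_inl, idef_tensorId]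
      refine hasMaj_tensorId κ majm ?_
      rw [idef_conj_eq, blockOf_comp_blockOf_eq]
      exact hasMaj_pullEquiv_comp _ (castT L i.K (curvCube L i)) majm (h8.mono fun y y' => wk y y')
  | inr μ =>
    obtain ⟨-, -, h3, -, -, h6, -, -, h9⟩ := H i.K i.one_le_K 1 le_rfl i.m (curvCube L i) (fun _ => rfl) msq hmsq hcap i.Msz μ
    refine ⟨?_, ?_, ?_⟩
    · rw [covPieces_flat_coarse_inr]
      exact hasMaj_tensorId κ maj0 h3
    · rw [covPieces_flat_fine_inr, blockOf_comp_blockOf_eq]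
      exact hasMaj_tensorId κ maj0 (hasMaj_conjEquiv _ _ (castT L i.K (curvCube L i)) maj0 h6)
    · rw [covPieces_flat_fine_inr, covPieces_flat_coarse_inr, idef_tensorId]
      refine hasMaj_tensorId κ majm ?_
      rw [idef_conj_eq, blockOf_comp_blockOf_eq]
      exact hasMaj_pullEquiv_comp _ (castT L i.K (curvCube L i)) majm (h9.mono fun y y' => wk y y')

end Summit.QuantumFields.YangMills.BalabanUVNodes.N15.SiteLayerBg

end
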